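/-
Copyright (c) 2026 the pub-hodgecm-mathlib formalisation cell (harness21).  Prover seat hodgecm-mathlib-K2E3-p32 (g0), HCML Track B «K2-LIT» (close-out strike line L4
`stub_StCharTS`), h413 = `stmt-HodgeConjecture-24833`, line `K2_E3_EllipticInputs`, unit U4 «Keys», PART «U4Keys» socket :155 (U4f-χ₁-ram-one-d0B)
`sig_K2E3KeysThmTwoContractingRamifiedCharOneDepthZeroNormTrivial` (LINE-LEAD K2E3-plan (g5), deal D162 «d0B lead ∕ consumer», cell «U4-RAM»; plan of record K2E3-p06 (g4)
DESIGN-M2-v2 (O2) ∕ PAPER-Z3-DepthZeroInert §1–§3; Z3-c SHARED FRAME v1 (K2E3-p03 (g9))): THE d0B END ASSEMBLY FROM `det M = 0` — frame-free on four complex entries, and on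
`U(Φ₃)(L⁺_v)` with the constant entries discharged.  2026-09-04.
-/
import Summits.HodgeConjecture.HodgeConjecture.Theorems.K2E3KeysThmTwoDepthZeroBranchBConstants   -- ★ (this seat) `Λ_1 f_w = μ(N₀)`, `Λ_{w₀} f₁ = q⁻³μ(N₀)`, `μ(N₀) ≠ 0`, `|χ₁(ϖ̂)| < 1` on `U(Φ₃)(L⁺_v)`; brings the (G3)-frame
import Summits.HodgeConjecture.HodgeConjecture.Theorems.K2E3BranchBDeterminantLettersToRoot    -- ★ (this seat) Z3-d: four entries + `det M = 0` + `V ≠ 0` + `|Y| < 1 < q` ⟹ `Y = −1∕q` (★ Z4 inside)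
import Summits.HodgeConjecture.HodgeConjecture.Theorems.K2E3KeysThmTwoDepthZeroBranchBConversion  -- ★ Z5 (this seat): `Y = −1∕q` ⟹ `χ₁ = η·‖·‖^{1∕2}`, `η` a quadratic character extension
import HarnessLib

/-!
# K2 ∕ E3 «EllipticInputs», unit U4 «Keys» — (U4f-χ₁-ram-one-d0B) THE END ASSEMBLY FROM `det M = 0` AT AN INERT PLACE:
# the four Casselman-pair entries + `det M = 0` ⟹ `Y = χ₁(ϖ̂) = −1∕q` ⟹ `χ₁ = η · ‖·‖^{1∕2}`, `η|_{norms} = 1`, `η(ϖ̂) = −1` — the SECOND DISJUNCT of the socket :155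
# [Keys1984 §3, §7 Thm (2); Casselman1980 §3; Casselman1995 §6.4; Rogawski1990 §12.2]

Cell `pub/hodgecm-mathlib`, crux H413 = `stmt-HodgeConjecture-24833`, route of record `HCCMUnconditional`; chair K2-lead (g2), LINE-LEAD∕dealer K2E3-plan (g5), architect K2E3-p25
(g3); cell «U4-RAM» (Z3-c frame v1, K2E3-p03 (g9); typists K2E3-p26 (II)-a, R90-C10-p04 (II)-b2 ∕ ★ HaarFactsN, K2E3-p03 (II)-b3, R90-C10-p01 (II)-c).  THEOREMS ONLY (no `def`,
no `instance`, no `notation`, no named-fact hypothesis, no `sorry`); lane `--supports stmt-HodgeConjecture-24833 --as helper`, count-neutral.  NOT THE PAYER: `det M = 0` (★ Z2-B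
`K2E3BranchBDeterminantZeroDepthZero` from the type vector of a reducible `i(χ₁, 1)`, 📤 `K2E3TypeVectorInKernelDepthZeroCM`) and the two big-cell entries ((II)-c) enter as hypotheses.

THE POINT.  The last two arrows of PAPER-Z3's Branch-B argument, composed once so that every remaining input is a NAMED hypothesis in the frame-v1 letters (`Y = χ₁(ϖ̂)`, `q = N𝔭_v`,
`V`, a sign `ε₀` (`= χ₁(δ₀)`, `ε₀² = 1`), a sign `c₂` (`= χ₂(−1) = 1`, `c₂² = 1`)):
* **`exists_eta_of_det_eq_zero_of_pairEntries`** (FRAME-FREE): four complex numbers `Λ11 = c₂·(ε₀·((q−1)∕q²)·V·Y∕(1+Y))`, `Λww = −c₂·(ε₀·((q−1)∕q²)·V∕(1+Y))`, `Λw1 = V`,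
  `Λ1w = (q³)⁻¹·V` with `Λ11·Λww − Λw1·Λ1w = 0`, `V ≠ 0`, `|Y| < 1`; `v` non-split and unramified in `L`; `χ₁` continuous with `χ₁(u·σu) = 1` on units of valuation one (Branch B)
  ⟹ **`∃ η`, `IsQuadraticCharExtension σ η ∧ Continuous η ∧ χ₁ = η · halfModulusChar`** (★ `eq_neg_inv_of_det_eq_zero`, `1 < q` ★ `one_lt_absNorm`, ★ Z5
  `exists_eta_of_branchB_of_apply_uniformizer_eq_neg_inv_absNorm`).
* **`exists_eta_of_det_eq_zero_of_bigCellEntries`** (on `U(Φ₃)(L⁺_v)`, (G3)-frame): for a normalised `(I, χ̃)`-type basis `(f₁, f_w)` of `i(χ₁, 1)` (contracting `χ₁`, Haar `μ` on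
  `N`), `det M = 0` on the four integrals + the two BIG-CELL entries `Λ_1 f₁`, `Λ_{w₀} f_w` in the frame-v1 shapes with `V := μ(N₀)` ⟹ the same conclusion — the constant entries
  `Λ_1 f_w = μ(N₀)`, `Λ_{w₀} f₁ = q⁻³μ(N₀)`, `μ(N₀) ≠ 0`, `|Y| < 1` being ★ `K2E3KeysThmTwoDepthZeroBranchBConstants`.
WHAT REMAINS for :155 at an inert odd `v`: `det M = 0` from reducibility (★ B + 📤 type vector + the two integrabilities `hi₁₁`, `hiw₂`) and the two big-cell entries `h11v`, `hwwv` ((II)-c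
over (II)-a∕(II)-b2∕(II)-b3); dyadic inert and ramified `v` are separate theorems.
HONEST LABEL.  HC_CM is proved only modulo the 7 printed citations (2 remaining named inputs: hLiu418 = `stmt-HodgeConjecture-24832`, h413 = `stmt-HodgeConjecture-24833`) until rung 0
closes; count-neutral — this file does NOT pay the leaf; no printed citation is discharged.

## References
* [Keys1984] D. Keys, Compositio Math. 51 (1984), §3, §7 Theorem (2) p. 126.
* [Casselman1980] W. Casselman, Compositio Math. 40 (1980), §3.
* [Casselman1995] W. Casselman, *Introduction to the theory of admissible representations of `p`-adic reductive groups* (1995), §6.4, Thm. 6.6.2.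
* [Rogawski1990] J. Rogawski, Ann. of Math. Stud. 123 (1990), §12.2 (1)–(2) p. 173.
-/

set_option autoImplicit false
-- the mandated namespace has the single-problem summit's repeated segment (`HodgeConjecture.HodgeConjecture`)
set_option linter.dupNamespace false

noncomputable section

open NumberField IsDedekindDomain MeasureTheory
open scoped Matrix MatrixGroups WithZero Valued
open Literature.NumberTheory Literature.NumberTheory.Automorphic Literature.NumberTheory.Automorphic.UnitaryGroup
open Literature.NumberTheory.Rogawski1990

namespace Summit.HodgeConjecture.HodgeConjecture.Cruxes.H413.K2E3KeysThmTwoDepthZeroBranchBFromDet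

open Summit.HodgeConjecture.HodgeConjecture.Cruxes.H413
open Summit.HodgeConjecture.HodgeConjecture.Cruxes.H413.K2E3DepthZeroIwahoriCharacterCM
open Summit.HodgeConjecture.HodgeConjecture.Cruxes.H413.K2E3BranchATorusWitnessCM
open Summit.HodgeConjecture.HodgeConjecture.Cruxes.H413.K2E3BranchATypeLettersCM

variable (L : Type) [Field L] [NumberField L] [IsCMField L] (v : HeightOneSpectrum (𝓞 ↥(maximalRealSubfield L)))
  (w : PlacesOver L v) (hw : IsCMField.complexConj L • w.1 = w.1)
  (eA : Gqs L v ≃ₜ* ↥(unitaryGroupOfForm (galAdicCompletionMap (L := L) (IsCMField.complexConj L) hw) ((StdForm.antidiagonal 3).over (w.1.adicCompletion L))))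
  (heA : ∀ g : Gqs L v,
    ((eA g : ↥(unitaryGroupOfForm (galAdicCompletionMap (L := L) (IsCMField.complexConj L) hw) ((StdForm.antidiagonal 3).over (w.1.adicCompletion L)))) :
        GL (Fin 3) (w.1.adicCompletion L)) =
      ((localNonsplitEquiv (IsCMField.complexConj L) (qsForm L) (IsCMField.complexConj_ne_one L) w hw g :
        ↥(unitaryGroupOfForm (galAdicCompletionMap (L := L) (IsCMField.complexConj L) hw) (placeForm (qsForm L) w.1))) : GL (Fin 3) (w.1.adicCompletion L)))
  {ϖ : w.1.adicCompletion L} (hϖ : Valued.v ϖ = WithZero.exp (-1 : ℤ))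
  (g₁ : GL (Fin 3) (w.1.adicCompletion L)) (hg₁ : (g₁ : Matrix (Fin 3) (Fin 3) (w.1.adicCompletion L)) = Matrix.diagonal ![(1 : w.1.adicCompletion L), 1, ϖ])
  (K0 K1 I : Subgroup (Gqs L v))
  (hK0 : K0 = ((glInt 3 (w.1.adicCompletion L)).subgroupOf
    (unitaryGroupOfForm (galAdicCompletionMap (L := L) (IsCMField.complexConj L) hw) ((StdForm.antidiagonal 3).over (w.1.adicCompletion L)))).comap
      eA.toMulEquiv.toMonoidHom)
  (hK1 : K1 = (((glInt 3 (w.1.adicCompletion L)).map (MulAut.conj g₁).toMonoidHom).subgroupOf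
    (unitaryGroupOfForm (galAdicCompletionMap (L := L) (IsCMField.complexConj L) hw) ((StdForm.antidiagonal 3).over (w.1.adicCompletion L)))).comap
      eA.toMulEquiv.toMonoidHom)
  (hI : I = K0 ⊓ K1)

/-! ## §1 Frame-free: the four entries + `det M = 0` ⟹ `χ₁ = η · ‖·‖^{1∕2}` -/

/-- **THE END ASSEMBLY FROM `det M = 0`, FRAME-FREE.**  `v` non-split and UNRAMIFIED in `L`; `χ₁` continuous with `χ₁(u·σu) = 1` on the units of valuation one (Branch B); letters
`V ≠ 0`, `ε₀² = 1`, `c₂² = 1`; `Y = χ₁(ϖ̂)` with `|Y| < 1`, `q = N𝔭_v`; four complex numbers `Λ11 = c₂·(ε₀·((q−1)∕q²)·V·Y∕(1+Y))`, `Λww = −c₂·(ε₀·((q−1)∕q²)·V∕(1+Y))`, `Λw1 = V`,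
`Λ1w = (q³)⁻¹·V` (PAPER-Z3 §1: `G₁, G₂, vol N₀, vol N(𝔭)`) with `Λ11·Λww − Λw1·Λ1w = 0` (PAPER-Z3 §2: `det M = 0`).  Then **`χ₁ = η · ‖·‖^{1∕2}` for a continuous quadratic character
extension `η`** (the second disjunct of :155): ★ `eq_neg_inv_of_det_eq_zero` (`1 < q` ★ `NumberField.HeightOneSpectrum.one_lt_absNorm`) gives `Y = −1∕q`, ★ Z5
`exists_eta_of_branchB_of_apply_uniformizer_eq_neg_inv_absNorm` converts. [cite: Keys1984, §3, §7 Theorem (2) p. 126] [cite: Casselman1980, §3] [cite: Rogawski1990, §12.2 (1)–(2) p. 173] -/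
theorem exists_eta_of_det_eq_zero_of_pairEntries
    (hns : ∀ w' : PlacesOver L v, IsCMField.complexConj L • w'.1 = w'.1) (hunr : Algebra.IsUnramifiedIn (𝓞 L) v.asIdeal)
    (χ₁ : (LocalRing L v)ˣ →* ℂˣ) (h₁ : Continuous fun x => ((χ₁ x : ℂˣ) : ℂ))
    (hB : ∀ u : (LocalRing L v)ˣ, (∀ w' : PlacesOver L v, Valued.v ((u : LocalRing L v) w') = 1) →
      χ₁ (u * Units.map (conjLocal L (IsCMField.complexConj L) v : LocalRing L v →* LocalRing L v) u) = 1)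
    (V ε₀ c₂ Λ11 Λ1w Λw1 Λww : ℂ) (hV : V ≠ 0) (hε : ε₀ ^ 2 = 1) (hc : c₂ ^ 2 = 1) (hY : ‖((χ₁ (isUnit_toLocalRing_uniformizer L v).unit : ℂˣ) : ℂ)‖ < 1)
    (h11v : Λ11 = c₂ * (ε₀ * ((((Ideal.absNorm v.asIdeal : ℝ) : ℂ) - 1) / ((Ideal.absNorm v.asIdeal : ℝ) : ℂ) ^ 2) * V * ((χ₁ (isUnit_toLocalRing_uniformizer L v).unit : ℂˣ) : ℂ) / (1 + ((χ₁ (isUnit_toLocalRing_uniformizer L v).unit : ℂˣ) : ℂ))))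
    (hwwv : Λww = -(c₂ * (ε₀ * ((((Ideal.absNorm v.asIdeal : ℝ) : ℂ) - 1) / ((Ideal.absNorm v.asIdeal : ℝ) : ℂ) ^ 2) * V / (1 + ((χ₁ (isUnit_toLocalRing_uniformizer L v).unit : ℂˣ) : ℂ)))))
    (hw1v : Λw1 = V) (h1wv : Λ1w = (((Ideal.absNorm v.asIdeal : ℝ) : ℂ) ^ 3)⁻¹ * V)
    (hdet : Λ11 * Λww - Λw1 * Λ1w = 0) :
    ∃ η : (LocalRing L v)ˣ →* ℂˣ, IsQuadraticCharExtension (conjLocal L (IsCMField.complexConj L) v) η ∧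
      Continuous (fun x => ((η x : ℂˣ) : ℂ)) ∧ χ₁ = η * halfModulusChar (LocalRing L v) := by
  have hq : (1 : ℝ) < (Ideal.absNorm v.asIdeal : ℝ) := by exact_mod_cast NumberField.HeightOneSpectrum.one_lt_absNorm v
  have hroot := K2E3BranchBDeterminantLettersToRoot.eq_neg_inv_of_det_eq_zero (Ideal.absNorm v.asIdeal : ℝ) hq ((χ₁ (isUnit_toLocalRing_uniformizer L v).unit : ℂˣ) : ℂ) ε₀ c₂ V
    Λ11 Λ1w Λw1 Λww hY hε hc hV h11v hwwv hw1v h1wv hdet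
  rw [Complex.ofReal_natCast] at hroot
  exact K2E3KeysThmTwoDepthZeroBranchBConversion.exists_eta_of_branchB_of_apply_uniformizer_eq_neg_inv_absNorm L v hns hunr χ₁ h₁ hB hroot

/-! ## §2 On `U(Φ₃)(L⁺_v)`: `det M = 0` + the two big-cell entries ⟹ `χ₁ = η · ‖·‖^{1∕2}` -/

open Classical in
include hw heA hϖ hg₁ hK0 hK1 hI in
set_option maxHeartbeats 4000000 in
set_option synthInstance.maxHeartbeats 400000 in
-- the `SmoothInd` carrier on `U(Φ₃)(L⁺_v)` (class of ★ `K2E3KeysThmTwoDepthZeroBranchBConstants`)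
/-- **THE END ASSEMBLY FROM `det M = 0`, BIG-CELL FORM ON `U(Φ₃)(L⁺_v)`.**  In the (G3)-frame with `w₀` the element of matrix `Φ₃` and a Haar `μ` on `N(L⁺_v)`: `v` non-split and
UNRAMIFIED in `L`; `χ₁` continuous, contracting, with `χ₁(u·σu) = 1` on units of valuation one (Branch B); `(f₁, f_w)` a normalised `(I, χ̃)`-type basis of `i(χ₁, 1)`; signs `ε₀² = c₂² = 1`;
the two BIG-CELL entries `Λ_1 f₁ = c₂·(ε₀·((q−1)∕q²)·μ(N₀)·Y∕(1+Y))`, `Λ_{w₀} f_w = −c₂·(ε₀·((q−1)∕q²)·μ(N₀)∕(1+Y))` ((II)-c) and `det M = 0` on the four integrals (★ Z2-B).  Then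
**`χ₁ = η · ‖·‖^{1∕2}`, `η` a continuous quadratic character extension** — §1 with `V := μ(N₀)`, the constant entries `Λ_1 f_w = μ(N₀)` ★ `integral_weyl_one_eq`, `Λ_{w₀} f₁ =
q⁻³μ(N₀)` ★ `integral_weyl_weyl_eq`, `μ(N₀) ≠ 0` ★ `measureReal_setOf_mem_ne_zero`, `|Y| < 1` ★ `norm_apply_uniformizer_lt_one`. [cite: Keys1984, §3, §7 Theorem (2) p. 126]
[cite: Casselman1980, §3] [cite: Casselman1995, §6.4, Thm. 6.6.2] [cite: Rogawski1990, §12.2 (1)–(2) p. 173] -/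
theorem exists_eta_of_det_eq_zero_of_bigCellEntries
    (hns : ∀ w' : PlacesOver L v, IsCMField.complexConj L • w'.1 = w'.1) (hunr : Algebra.IsUnramifiedIn (𝓞 L) v.asIdeal)
    (χ₁ : (LocalRing L v)ˣ →* ℂˣ) (h₁ : Continuous fun x => ((χ₁ x : ℂˣ) : ℂ))
    (hcontr : ∀ x : (LocalRing L v)ˣ, unitModulusChar (LocalRing L v) x < 1 → ‖((χ₁ x : ℂˣ) : ℂ)‖ < 1)
    (hB : ∀ u : (LocalRing L v)ˣ, (∀ w' : PlacesOver L v, Valued.v ((u : LocalRing L v) w') = 1) →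
      χ₁ (u * Units.map (conjLocal L (IsCMField.complexConj L) v : LocalRing L v →* LocalRing L v) u) = 1)
    (w₀ : ↥(unitaryGroupOfForm (conjLocal L (IsCMField.complexConj L) v) (cmLocalForm L 3 v))) (hw₀ : Units.val (w₀ : GL (Fin 3) (LocalRing L v)) = cmLocalForm L 3 v)
    [instM : MeasurableSpace ↥(cmBorelTriple L 3 v).N] [instB : BorelSpace ↥(cmBorelTriple L 3 v).N] (μ : Measure ↥(cmBorelTriple L 3 v).N) [instH : μ.IsHaarMeasure]
    (f₁ f_w : haveI := locallyCompactSpace_cmBorelU L 3 v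
      Representation.SmoothInd (cmBorelTriple L 3 v).P
        (Representation.twist (((Representation.trivial ℂ ↥(torusU (conjLocal L (IsCMField.complexConj L) v) (cmLocalForm L 3 v)) ℂ).twist
          (cmTorusCharPair L v χ₁ 1)).comp (cmBorelTriple L 3 v).proj) (rootDeltaChar (cmBorelTriple L 3 v).P)))
    (heig₁ : ∀ x ∈ I, (haveI := locallyCompactSpace_cmBorelU L 3 v; Representation.smoothIndRep _ _ x f₁) = (if h : IsUnit (((x.val : GL (Fin 3) (LocalRing L v)) : Matrix (Fin 3) (Fin 3) (LocalRing L v)) 0 0) then ((χ₁ h.unit : ℂˣ) : ℂ) else 0) • f₁)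
    (heig_w : ∀ x ∈ I, (haveI := locallyCompactSpace_cmBorelU L 3 v; Representation.smoothIndRep _ _ x f_w) = (if h : IsUnit (((x.val : GL (Fin 3) (LocalRing L v)) : Matrix (Fin 3) (Fin 3) (LocalRing L v)) 0 0) then ((χ₁ h.unit : ℂˣ) : ℂ) else 0) • f_w)
    (h11 : f₁.toFun 1 = 1) (h1g : f₁.toFun w₀ = 0) (hw1 : f_w.toFun 1 = 0) (hwg : f_w.toFun w₀ = 1)
    (ε₀ c₂ : ℂ) (hε : ε₀ ^ 2 = 1) (hc : c₂ ^ 2 = 1)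
    (h11v : ∫ n : ↥(cmBorelTriple L 3 v).N, f₁.toFun (w₀ * (n : ↥(unitaryGroupOfForm (conjLocal L (IsCMField.complexConj L) v) (cmLocalForm L 3 v))) * 1) ∂μ =
      c₂ * (ε₀ * ((((Ideal.absNorm v.asIdeal : ℝ) : ℂ) - 1) / ((Ideal.absNorm v.asIdeal : ℝ) : ℂ) ^ 2) * ((μ.real {m : ↥(cmBorelTriple L 3 v).N | (m : ↥(unitaryGroupOfForm (conjLocal L (IsCMField.complexConj L) v) (cmLocalForm L 3 v))) ∈ I} : ℝ) : ℂ) * ((χ₁ (isUnit_toLocalRing_uniformizer L v).unit : ℂˣ) : ℂ) / (1 + ((χ₁ (isUnit_toLocalRing_uniformizer L v).unit : ℂˣ) : ℂ))))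
    (hwwv : ∫ n : ↥(cmBorelTriple L 3 v).N, f_w.toFun (w₀ * (n : ↥(unitaryGroupOfForm (conjLocal L (IsCMField.complexConj L) v) (cmLocalForm L 3 v))) * w₀) ∂μ =
      -(c₂ * (ε₀ * ((((Ideal.absNorm v.asIdeal : ℝ) : ℂ) - 1) / ((Ideal.absNorm v.asIdeal : ℝ) : ℂ) ^ 2) * ((μ.real {m : ↥(cmBorelTriple L 3 v).N | (m : ↥(unitaryGroupOfForm (conjLocal L (IsCMField.complexConj L) v) (cmLocalForm L 3 v))) ∈ I} : ℝ) : ℂ) / (1 + ((χ₁ (isUnit_toLocalRing_uniformizer L v).unit : ℂˣ) : ℂ)))))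
    (hdet : (∫ n : ↥(cmBorelTriple L 3 v).N, f₁.toFun (w₀ * (n : ↥(unitaryGroupOfForm (conjLocal L (IsCMField.complexConj L) v) (cmLocalForm L 3 v))) * 1) ∂μ) * (∫ n : ↥(cmBorelTriple L 3 v).N, f_w.toFun (w₀ * (n : ↥(unitaryGroupOfForm (conjLocal L (IsCMField.complexConj L) v) (cmLocalForm L 3 v))) * w₀) ∂μ) - (∫ n : ↥(cmBorelTriple L 3 v).N, f_w.toFun (w₀ * (n : ↥(unitaryGroupOfForm (conjLocal L (IsCMField.complexConj L) v) (cmLocalForm L 3 v))) * 1) ∂μ) * (∫ n : ↥(cmBorelTriple L 3 v).N, f₁.toFun (w₀ * (n : ↥(unitaryGroupOfForm (conjLocal L (IsCMField.complexConj L) v) (cmLocalForm L 3 v))) * w₀) ∂μ) = 0) :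
    ∃ η : (LocalRing L v)ˣ →* ℂˣ, IsQuadraticCharExtension (conjLocal L (IsCMField.complexConj L) v) η ∧
      Continuous (fun x => ((η x : ℂˣ) : ℂ)) ∧ χ₁ = η * halfModulusChar (LocalRing L v) :=
  exists_eta_of_det_eq_zero_of_pairEntries L v hns hunr χ₁ h₁ hB ((μ.real {m : ↥(cmBorelTriple L 3 v).N | (m : ↥(unitaryGroupOfForm (conjLocal L (IsCMField.complexConj L) v) (cmLocalForm L 3 v))) ∈ I} : ℝ) : ℂ) ε₀ c₂
    (∫ n : ↥(cmBorelTriple L 3 v).N, f₁.toFun (w₀ * (n : ↥(unitaryGroupOfForm (conjLocal L (IsCMField.complexConj L) v) (cmLocalForm L 3 v))) * 1) ∂μ) (∫ n : ↥(cmBorelTriple L 3 v).N, f₁.toFun (w₀ * (n : ↥(unitaryGroupOfForm (conjLocal L (IsCMField.complexConj L) v) (cmLocalForm L 3 v))) * w₀) ∂μ) (∫ n : ↥(cmBorelTriple L 3 v).N, f_w.toFun (w₀ * (n : ↥(unitaryGroupOfForm (conjLocal L (IsCMField.complexConj L) v) (cmLocalForm L 3 v))) * 1) ∂μ) (∫ n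 : ↥(cmBorelTriple L 3 v).N, f_w.toFun (w₀ * (n : ↥(unitaryGroupOfForm (conjLocal L (IsCMField.complexConj L) v) (cmLocalForm L 3 v))) * w₀) ∂μ)
    (K2E3KeysThmTwoDepthZeroBranchBConstants.measureReal_setOf_mem_ne_zero L v w hw eA g₁ K0 K1 I hK0 hK1 hI μ) hε hc
    (K2E3KeysThmTwoDepthZeroBranchBConstants.norm_apply_uniformizer_lt_one L v w hw hunr χ₁ hcontr) h11v hwwv
    (K2E3KeysThmTwoDepthZeroBranchBConstants.integral_weyl_one_eq L v w hw eA heA hϖ g₁ hg₁ K0 K1 I hK0 hK1 hI χ₁ w₀ hw₀ μ f_w heig_w hw1 hwg)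
    (K2E3KeysThmTwoDepthZeroBranchBConstants.integral_weyl_weyl_eq L v w hw eA heA hϖ g₁ hg₁ K0 K1 I hK0 hK1 hI χ₁ w₀ hw₀ μ f₁ heig₁ h11 h1g hunr) hdet

end Summit.HodgeConjecture.HodgeConjecture.Cruxes.H413.K2E3KeysThmTwoDepthZeroBranchBFromDet

end
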